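import Mathlib
import Summits.MatrixMultiplication.MatrixMultiplication.Theses.LevelGradedCohnUmans

/-!
# `SnLevelDesigns` (stmt-MatrixMultiplication-7613), line `garnir-annihilator`:
# J3 `stub_hostedMiddleWall` — a frame-transitive host inside the middle difference set caps `|X|·|Z|` at `C(n,k)²`

Crux `Summit.MatrixMultiplication.MatrixMultiplication.Theses.LevelGradedCohnUmans.SnLevelDesigns`;
skeleton `Cruxes/SnLevelDesigns/Lines/garnir_annihilator.lean` (lead c1 reshape 4, registered stub J3);
this file proves the registered stub `stub_hostedMiddleWall` verbatim (name + signature, tree-only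
vocabulary) and lands `--supports stmt-MatrixMultiplication-7613`.

JUNTA separation of a triple `X, Y, Z ⊆ 𝔖ₙ` at level `k`: every target `t = x₀⁻¹ z₀` is told apart
from each garbage product `x⁻¹ y y'⁻¹ z` (`(x, y, z) ≠ (x₀, y', z₀)`) by the restriction to one frame
`ι : Fin k → Fin n` chosen per target.  The route's named candidate host is `G = AGL_d(𝔽_q) < 𝔖_{q^d}`
at `k = d + 1`; abstractly we assume of a subgroup `G ≤ 𝔖ₙ`:
* (H1) every set of `< k` points is fixed pointwise by a non-trivial element of `G`;
* (H2) `G` is transitive on the injective `k`-frames whose image has trivial pointwise stabiliser;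
* (H3) the difference set of the middle set covers `G`: every `g ∈ G` is `y * y'⁻¹` with `y, y' ∈ Y`.
CONCLUSION: `|X| · |Z| ≤ C(n,k) · C(n,k)`.  (With the token wall `|X||Y| ≤ D_k` this caps the volume at
`C(n,k) · D_k ≈ D_k^{3/2} / √(k!)`: the AGL-hosted middle is dead for junta certificates.)

PROOF.  (0) For a target `(x₀, z₀)` with frame `ι` the pointwise stabiliser in `G` of
`W := z₀ (im ι)` is trivial: a non-trivial `g = y y'⁻¹` in it has `y ≠ y'`, and the garbage
`(x₀, y, y', z₀)` has product `x₀⁻¹ g z₀`, which agrees with `x₀⁻¹ z₀` on `ι` (`hmw_stab`).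
(1) Hence `ι` is injective by (H1) (`hmw_frame_injective`).  (2) X-side: fix `z₀`; if two targets
`(x₀, z₀), (x₁, z₀)` with frames `ι₀, ι₁` have the same `k`-set `V = (x₀⁻¹ z₀)(im ι₀) = (x₁⁻¹ z₀)(im ι₁)`,
the frames `φ = z₀ ∘ ι₀` and `ψ = x₁ x₀⁻¹ ∘ z₀ ∘ ι₀` are injective with images `z₀(im ι₀)`, `z₀(im ι₁)`
of trivial stabiliser, so (H2) gives `g ∈ G` with `g ∘ φ = ψ`; writing `g = y y'⁻¹` (H3) the garbage
`(x₁, y, y', z₀)` agrees with the target `(x₀, z₀)` on `ι₀` — contradiction; so `x ↦ V` injects `X`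
into the `k`-subsets of `Fin n` (`hmw_card_X_le`).  (3) Z-side, symmetrically with `U = im ι`
for a fixed `x₀` (`hmw_card_Z_le`).
-/

-- the problem path repeats `MatrixMultiplication` (summit = problem), as in every file of this line
set_option linter.dupNamespace false

namespace Summit.MatrixMultiplication.MatrixMultiplication.Theorems.SnLevelDesigns

open Equiv

section HostedMiddle

variable {n k : ℕ} {X Y Z : Finset (Equiv.Perm (Fin n))} {G : Subgroup (Equiv.Perm (Fin n))}

/-- Step (0): the pointwise stabiliser in `G` of the window `z₀ (im ι)` of a junta-certified target
`(x₀, z₀)` is trivial — a non-trivial `g = y y'⁻¹ ∈ G` fixing it pointwise makes the garbage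
`(x₀, y, y', z₀)` agree with the target on `ι`. -/
theorem hmw_stab (h3 : ∀ g ∈ G, ∃ y ∈ Y, ∃ y' ∈ Y, g = y * y'⁻¹)
    {x₀ z₀ : Equiv.Perm (Fin n)} (hx₀ : x₀ ∈ X) (hz₀ : z₀ ∈ Z) {ι : Fin k → Fin n}
    (hι : ∀ x ∈ X, ∀ y ∈ Y, ∀ y' ∈ Y, ∀ z ∈ Z, ¬ (x = x₀ ∧ y = y' ∧ z = z₀) →
      (⇑(x⁻¹ * y * y'⁻¹ * z)) ∘ ι ≠ (⇑(x₀⁻¹ * z₀)) ∘ ι) :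
    ∀ g ∈ G, (∀ i, g (z₀ (ι i)) = z₀ (ι i)) → g = 1 := by
  intro g hg hfix
  by_contra hne
  obtain ⟨y, hy, y', hy', rfl⟩ := h3 g hg
  have hyy' : y ≠ y' := by
    rintro rfl
    exact hne (mul_inv_cancel y)
  refine hι x₀ hx₀ y hy y' hy' z₀ hz₀ (fun hh => hyy' hh.2.1) (funext fun i => ?_)
  have := hfix i
  simp only [Function.comp_apply, Perm.mul_apply] at this ⊢
  rw [this]

/-- Step (1): the frame of a junta-certified target is injective, by (H1) and step (0). -/
theorem hmw_frame_injective
    (h1 : ∀ S : Finset (Fin n), S.card < k → ∃ g ∈ G, g ≠ 1 ∧ ∀ s ∈ S, g s = s)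
    (h3 : ∀ g ∈ G, ∃ y ∈ Y, ∃ y' ∈ Y, g = y * y'⁻¹)
    {x₀ z₀ : Equiv.Perm (Fin n)} (hx₀ : x₀ ∈ X) (hz₀ : z₀ ∈ Z) {ι : Fin k → Fin n}
    (hι : ∀ x ∈ X, ∀ y ∈ Y, ∀ y' ∈ Y, ∀ z ∈ Z, ¬ (x = x₀ ∧ y = y' ∧ z = z₀) →
      (⇑(x⁻¹ * y * y'⁻¹ * z)) ∘ ι ≠ (⇑(x₀⁻¹ * z₀)) ∘ ι) :
    Function.Injective ι := by
  classical
  by_contra hni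
  -- the window `S = z₀ (im ι)` has fewer than `k` points
  set S : Finset (Fin n) := (Finset.univ.image ι).image z₀ with hS
  have hlt : (Finset.univ.image ι).card < k := by
    have hle : (Finset.univ.image ι).card ≤ (Finset.univ : Finset (Fin k)).card :=
      Finset.card_image_le
    have hne : (Finset.univ.image ι).card ≠ (Finset.univ : Finset (Fin k)).card := by
      intro heq
      apply hni
      intro a b hab
      exact Finset.card_image_iff.mp heq (Finset.mem_coe.2 (Finset.mem_univ a))
        (Finset.mem_coe.2 (Finset.mem_univ b)) hab
    have := lt_of_le_of_ne hle hne
    simpa using this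
  have hcard : S.card < k := lt_of_le_of_lt Finset.card_image_le hlt
  obtain ⟨g, hg, hg1, hfix⟩ := h1 S hcard
  refine hg1 (hmw_stab h3 hx₀ hz₀ hι g hg fun i => hfix _ ?_)
  rw [hS]
  exact Finset.mem_image.2 ⟨ι i, Finset.mem_image.2 ⟨i, Finset.mem_univ _, rfl⟩, rfl⟩

/-- Step (2), X-side: for a fixed `z₀ ∈ Z`, `x ↦ (x⁻¹ z₀)(im ι_{(x,z₀)})` injects `X` into the
`k`-subsets of `Fin n`, so `|X| ≤ C(n,k)`. -/
theorem hmw_card_X_le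
    (h1 : ∀ S : Finset (Fin n), S.card < k → ∃ g ∈ G, g ≠ 1 ∧ ∀ s ∈ S, g s = s)
    (h2 : ∀ φ ψ : Fin k → Fin n, Function.Injective φ → Function.Injective ψ →
        (∀ g ∈ G, (∀ i, g (φ i) = φ i) → g = 1) → (∀ g ∈ G, (∀ i, g (ψ i) = ψ i) → g = 1) →
        ∃ g ∈ G, ∀ i, g (φ i) = ψ i)
    (h3 : ∀ g ∈ G, ∃ y ∈ Y, ∃ y' ∈ Y, g = y * y'⁻¹)
    (hJ : ∀ x₀ ∈ X, ∀ z₀ ∈ Z, ∃ ι : Fin k → Fin n, ∀ x ∈ X, ∀ y ∈ Y, ∀ y' ∈ Y, ∀ z ∈ Z,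
        ¬ (x = x₀ ∧ y = y' ∧ z = z₀) → (⇑(x⁻¹ * y * y'⁻¹ * z)) ∘ ι ≠ (⇑(x₀⁻¹ * z₀)) ∘ ι)
    {z₀ : Equiv.Perm (Fin n)} (hz₀ : z₀ ∈ Z) : X.card ≤ n.choose k := by
  classical
  -- `V x` = the `k`-set `(x⁻¹ z₀)(im ι)` of the target `(x, z₀)` (`∅` off `X`)
  let V : Equiv.Perm (Fin n) → Finset (Fin n) := fun x =>
    if hx : x ∈ X then Finset.univ.image (fun i => (x⁻¹ * z₀) ((hJ x hx z₀ hz₀).choose i)) else ∅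
  have hmaps : Set.MapsTo V ↑X ↑(Finset.powersetCard k (Finset.univ : Finset (Fin n))) := by
    intro x hx
    have hx' : x ∈ X := Finset.mem_coe.1 hx
    rw [Finset.mem_coe, Finset.mem_powersetCard]
    refine ⟨Finset.subset_univ _, ?_⟩
    have hinj : Function.Injective (hJ x hx' z₀ hz₀).choose :=
      hmw_frame_injective h1 h3 hx' hz₀ (hJ x hx' z₀ hz₀).choose_spec
    have hinj' : Function.Injective (fun i => (x⁻¹ * z₀) ((hJ x hx' z₀ hz₀).choose i)) :=
      fun i j hij => hinj ((x⁻¹ * z₀).injective hij)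
    simp only [V, dif_pos hx']
    rw [Finset.card_image_of_injective _ hinj', Finset.card_univ, Fintype.card_fin]
  have hinjOn : Set.InjOn V ↑X := by
    intro x₀ hx₀ x₁ hx₁ hV
    have hx₀' : x₀ ∈ X := Finset.mem_coe.1 hx₀
    have hx₁' : x₁ ∈ X := Finset.mem_coe.1 hx₁
    by_contra hne
    set ι₀ := (hJ x₀ hx₀' z₀ hz₀).choose with hι₀def
    have hι₀ := (hJ x₀ hx₀' z₀ hz₀).choose_spec
    set ι₁ := (hJ x₁ hx₁' z₀ hz₀).choose with hι₁def
    have hι₁ := (hJ x₁ hx₁' z₀ hz₀).choose_spec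
    rw [← hι₀def] at hι₀
    rw [← hι₁def] at hι₁
    have hV' : Finset.univ.image (fun i => (x₀⁻¹ * z₀) (ι₀ i)) =
        Finset.univ.image (fun i => (x₁⁻¹ * z₀) (ι₁ i)) := by
      simpa only [V, dif_pos hx₀', dif_pos hx₁'] using hV
    have hinj₀ : Function.Injective ι₀ := hmw_frame_injective h1 h3 hx₀' hz₀ hι₀
    -- the two frames of (H2)
    let φ : Fin k → Fin n := fun i => z₀ (ι₀ i)
    let ψ : Fin k → Fin n := fun i => x₁ (x₀⁻¹ (z₀ (ι₀ i)))
    have hφ : Function.Injective φ := z₀.injective.comp hinj₀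
    have hψ : Function.Injective ψ := x₁.injective.comp (x₀⁻¹.injective.comp hφ)
    have hφs : ∀ g ∈ G, (∀ i, g (φ i) = φ i) → g = 1 := hmw_stab h3 hx₀' hz₀ hι₀
    have hψs : ∀ g ∈ G, (∀ i, g (ψ i) = ψ i) → g = 1 := by
      intro g hg hfix
      refine hmw_stab h3 hx₁' hz₀ hι₁ g hg fun j => ?_
      -- `(x₁⁻¹ z₀)(ι₁ j) ∈ V x₁ = V x₀`, so it is `(x₀⁻¹ z₀)(ι₀ i)` for some `i`
      have hmem : (x₁⁻¹ * z₀) (ι₁ j) ∈ Finset.univ.image (fun i => (x₀⁻¹ * z₀) (ι₀ i)) := by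
        rw [hV']
        exact Finset.mem_image.2 ⟨j, Finset.mem_univ _, rfl⟩
      obtain ⟨i, -, hi⟩ := Finset.mem_image.1 hmem
      have hψi : ψ i = z₀ (ι₁ j) := by
        have hi' : x₀⁻¹ (z₀ (ι₀ i)) = x₁⁻¹ (z₀ (ι₁ j)) := by simpa only [Perm.mul_apply] using hi
        show x₁ (x₀⁻¹ (z₀ (ι₀ i))) = z₀ (ι₁ j)
        rw [hi']
        simp
      have := hfix i
      rwa [hψi] at this
    obtain ⟨g, hg, hgφ⟩ := h2 φ ψ hφ hψ hφs hψs
    obtain ⟨y, hy, y', hy', hgy⟩ := h3 g hg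
    refine hι₀ x₁ hx₁' y hy y' hy' z₀ hz₀ (fun hh => hne hh.1.symm) (funext fun i => ?_)
    have hgi : g (z₀ (ι₀ i)) = x₁ (x₀⁻¹ (z₀ (ι₀ i))) := hgφ i
    simp only [Function.comp_apply, Perm.mul_apply]
    have hyy : y (y'⁻¹ (z₀ (ι₀ i))) = g (z₀ (ι₀ i)) := by rw [hgy, Perm.mul_apply]
    rw [hyy, hgi]
    simp
  calc X.card ≤ (Finset.powersetCard k (Finset.univ : Finset (Fin n))).card :=
        Finset.card_le_card_of_injOn V hmaps hinjOn
    _ = n.choose k := by rw [Finset.card_powersetCard, Finset.card_univ, Fintype.card_fin]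

/-- Step (3), Z-side: for a fixed `x₀ ∈ X`, `z ↦ im ι_{(x₀,z)}` injects `Z` into the `k`-subsets
of `Fin n`, so `|Z| ≤ C(n,k)`. -/
theorem hmw_card_Z_le
    (h1 : ∀ S : Finset (Fin n), S.card < k → ∃ g ∈ G, g ≠ 1 ∧ ∀ s ∈ S, g s = s)
    (h2 : ∀ φ ψ : Fin k → Fin n, Function.Injective φ → Function.Injective ψ →
        (∀ g ∈ G, (∀ i, g (φ i) = φ i) → g = 1) → (∀ g ∈ G, (∀ i, g (ψ i) = ψ i) → g = 1) →
        ∃ g ∈ G, ∀ i, g (φ i) = ψ i)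
    (h3 : ∀ g ∈ G, ∃ y ∈ Y, ∃ y' ∈ Y, g = y * y'⁻¹)
    (hJ : ∀ x₀ ∈ X, ∀ z₀ ∈ Z, ∃ ι : Fin k → Fin n, ∀ x ∈ X, ∀ y ∈ Y, ∀ y' ∈ Y, ∀ z ∈ Z,
        ¬ (x = x₀ ∧ y = y' ∧ z = z₀) → (⇑(x⁻¹ * y * y'⁻¹ * z)) ∘ ι ≠ (⇑(x₀⁻¹ * z₀)) ∘ ι)
    {x₀ : Equiv.Perm (Fin n)} (hx₀ : x₀ ∈ X) : Z.card ≤ n.choose k := by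
  classical
  -- `U z` = the window `im ι` of the target `(x₀, z)` (`∅` off `Z`)
  let U : Equiv.Perm (Fin n) → Finset (Fin n) := fun z =>
    if hz : z ∈ Z then Finset.univ.image (hJ x₀ hx₀ z hz).choose else ∅
  have hmaps : Set.MapsTo U ↑Z ↑(Finset.powersetCard k (Finset.univ : Finset (Fin n))) := by
    intro z hz
    have hz' : z ∈ Z := Finset.mem_coe.1 hz
    rw [Finset.mem_coe, Finset.mem_powersetCard]
    refine ⟨Finset.subset_univ _, ?_⟩
    have hinj : Function.Injective (hJ x₀ hx₀ z hz').choose :=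
      hmw_frame_injective h1 h3 hx₀ hz' (hJ x₀ hx₀ z hz').choose_spec
    simp only [U, dif_pos hz']
    rw [Finset.card_image_of_injective _ hinj, Finset.card_univ, Fintype.card_fin]
  have hinjOn : Set.InjOn U ↑Z := by
    intro z₀ hz₀ z₁ hz₁ hU
    have hz₀' : z₀ ∈ Z := Finset.mem_coe.1 hz₀
    have hz₁' : z₁ ∈ Z := Finset.mem_coe.1 hz₁
    by_contra hne
    set ι₀ := (hJ x₀ hx₀ z₀ hz₀').choose with hι₀def
    have hι₀ := (hJ x₀ hx₀ z₀ hz₀').choose_spec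
    set ι₁ := (hJ x₀ hx₀ z₁ hz₁').choose with hι₁def
    have hι₁ := (hJ x₀ hx₀ z₁ hz₁').choose_spec
    rw [← hι₀def] at hι₀
    rw [← hι₁def] at hι₁
    have hU' : Finset.univ.image ι₀ = Finset.univ.image ι₁ := by
      simpa only [U, dif_pos hz₀', dif_pos hz₁'] using hU
    have hinj₀ : Function.Injective ι₀ := hmw_frame_injective h1 h3 hx₀ hz₀' hι₀
    let φ : Fin k → Fin n := fun i => z₀ (ι₀ i)
    let ψ : Fin k → Fin n := fun i => z₁ (ι₀ i)
    have hφ : Function.Injective φ := z₀.injective.comp hinj₀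
    have hψ : Function.Injective ψ := z₁.injective.comp hinj₀
    have hφs : ∀ g ∈ G, (∀ i, g (φ i) = φ i) → g = 1 := hmw_stab h3 hx₀ hz₀' hι₀
    have hψs : ∀ g ∈ G, (∀ i, g (ψ i) = ψ i) → g = 1 := by
      intro g hg hfix
      refine hmw_stab h3 hx₀ hz₁' hι₁ g hg fun j => ?_
      have hmem : ι₁ j ∈ Finset.univ.image ι₀ := by
        rw [hU']
        exact Finset.mem_image.2 ⟨j, Finset.mem_univ _, rfl⟩
      obtain ⟨i, -, hi⟩ := Finset.mem_image.1 hmem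
      have := hfix i
      simp only [ψ] at this
      rwa [hi] at this
    obtain ⟨g, hg, hgφ⟩ := h2 φ ψ hφ hψ hφs hψs
    obtain ⟨y, hy, y', hy', hgy⟩ := h3 g⁻¹ (G.inv_mem hg)
    refine hι₀ x₀ hx₀ y hy y' hy' z₁ hz₁' (fun hh => hne hh.2.2.symm) (funext fun i => ?_)
    have hgi : g (z₀ (ι₀ i)) = z₁ (ι₀ i) := hgφ i
    have hgi' : g⁻¹ (z₁ (ι₀ i)) = z₀ (ι₀ i) := by
      rw [Perm.inv_eq_iff_eq]
      exact hgi.symm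
    simp only [Function.comp_apply, Perm.mul_apply]
    have hyy : y (y'⁻¹ (z₁ (ι₀ i))) = g⁻¹ (z₁ (ι₀ i)) := by rw [hgy, Perm.mul_apply]
    rw [hyy, hgi']
  calc Z.card ≤ (Finset.powersetCard k (Finset.univ : Finset (Fin n))).card :=
        Finset.card_le_card_of_injOn U hmaps hinjOn
    _ = n.choose k := by rw [Finset.card_powersetCard, Finset.card_univ, Fintype.card_fin]

end HostedMiddle

/-- **`stub_hostedMiddleWall`** (registered stub J3 of crux stmt-MatrixMultiplication-7613, line
`garnir-annihilator`). If a subgroup `G ≤ 𝔖ₙ` satisfies (H1) every set of `< k` points has a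
non-trivial pointwise stabiliser in `G` and (H2) `G` is transitive on the injective `k`-frames whose
image has trivial pointwise stabiliser (e.g. `AGL_d(𝔽_q) < 𝔖_{q^d}`, `k = d + 1`, regular on affine
bases), and the middle difference set `YY⁻¹` covers `G` (H3), then a JUNTA-separated triple has
`|X| · |Z| ≤ C(n,k) · C(n,k)` (`hmw_card_X_le`, `hmw_card_Z_le`; empty `X` or `Z` trivially).
With the token wall this is `V ≤ C(n,k)·D_k ≈ D_k^{3/2}/√(k!)`: the AGL-hosted middle is dead for the
junta sub-certificate. -/
theorem stub_hostedMiddleWall :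
    ∀ (n k : ℕ) (X Y Z : Finset (Equiv.Perm (Fin n))) (G : Subgroup (Equiv.Perm (Fin n))),
      (∀ S : Finset (Fin n), S.card < k → ∃ g ∈ G, g ≠ 1 ∧ ∀ s ∈ S, g s = s) →
      (∀ φ ψ : Fin k → Fin n, Function.Injective φ → Function.Injective ψ →
          (∀ g ∈ G, (∀ i, g (φ i) = φ i) → g = 1) → (∀ g ∈ G, (∀ i, g (ψ i) = ψ i) → g = 1) →
          ∃ g ∈ G, ∀ i, g (φ i) = ψ i) →
      (∀ g ∈ G, ∃ y ∈ Y, ∃ y' ∈ Y, g = y * y'⁻¹) →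
      (∀ x₀ ∈ X, ∀ z₀ ∈ Z, ∃ ι : Fin k → Fin n, ∀ x ∈ X, ∀ y ∈ Y, ∀ y' ∈ Y, ∀ z ∈ Z,
          ¬ (x = x₀ ∧ y = y' ∧ z = z₀) → (⇑(x⁻¹ * y * y'⁻¹ * z)) ∘ ι ≠ (⇑(x₀⁻¹ * z₀)) ∘ ι) →
      X.card * Z.card ≤ n.choose k * n.choose k := by
  intro n k X Y Z G h1 h2 h3 hJ
  rcases X.eq_empty_or_nonempty with hX | ⟨x₀, hx₀⟩
  · simp [hX]
  rcases Z.eq_empty_or_nonempty with hZ | ⟨z₀, hz₀⟩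
  · simp [hZ]
  exact Nat.mul_le_mul (hmw_card_X_le h1 h2 h3 hJ hz₀) (hmw_card_Z_le h1 h2 h3 hJ hx₀)

end Summit.MatrixMultiplication.MatrixMultiplication.Theorems.SnLevelDesigns
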